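import Literature.NumberTheory.Automorphic.TorusUnitBoxUnfolding
import HarnessLib

/-!
# Peeling off the good places of a torus integral: `∫_{B(Good ∖ F)} f = (∏_{v ∈ F} L_v) ∫_{B(Good)} f`
# and `∫ f = ⨆_F ∫_{B(Good ∖ F)} f ≤ (⨆_F ∏_{v ∈ F} L_v) · ∫_{B(Good)} f`
(Jacquet–Shalika (1981), §4; Cogdell (2004), §2.3: Euler factorisation / absolute convergence of torus integrals)

Topic `NumberTheory/Automorphic`; namespace `Literature.NumberTheory.Automorphic`. Proof file
(theorems only), sequel to `TorusUnitBoxUnfolding`. For a measurable `f ≥ 0` on the adelic torus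
`(𝔸_Kˣ)ⁿ` which, at every place `v` of a set `Good`, vanishes at the points having an entry of
`v`-valuation `> 1` and scales by `c_v(μ)` under the translation by `ϖ_v^μ` of points that are units at
`v`:

* `setLIntegral_unitBox_diff_eq_prod_mul` — for every finite `F ⊆ Good`,
  `∫_{B(Good ∖ F)} f dν = (∏_{v ∈ F} Σ_μ c_v(μ)) · ∫_{B(Good)} f dν` (induction on `F`,
  `setLIntegral_unitBox_eq_tsum_mul` one place at a time);
* `iUnion_unitBox_diff_eq_univ` — `⋃_F B(Good ∖ F) = (𝔸_Kˣ)ⁿ` over the finite `F ⊆ Good` (an idele is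
  a unit at almost all places);
* `lintegral_eq_iSup_setLIntegral_unitBox_diff` — `∫ f dν = ⨆_F ∫_{B(Good ∖ F)} f dν`
  (`setLIntegral_iUnion_of_directed`; the finite places are countable);
* `lintegral_le_iSup_prod_mul_setLIntegral_unitBox` (**main**) —
  `∫ f dν ≤ (⨆_F ∏_{v ∈ F} Σ_μ c_v(μ)) · ∫_{B(Good)} f dν`: the whole torus integral is controlled by
  the integral over the unit box at `Good` and the Euler product of the local factors.

## References

* H. Jacquet, J. A. Shalika, Amer. J. Math. 103 (1981), §4 [JacquetShalikaAJM1981].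
* J. W. Cogdell, *Analytic theory of L-functions for GL_n* (2004), §2.3 [CogdellAnalyticTheory2004].
-/

noncomputable section

open MeasureTheory Measure NumberField IsDedekindDomain Set Filter Topology
open Literature.NumberTheory.GaloisRepresentations (ideleGroup localUnits)
open scoped ENNReal NNReal Pointwise

namespace Literature.NumberTheory.Automorphic

section Euler

variable {n : ℕ} {K : Type} [Field K] [NumberField K]
variable [MeasurableSpace (ideleGroup K)] [BorelSpace (ideleGroup K)]

attribute [local instance] secondCountableTopology_ideleGroup

variable (νA : Measure (Fin n → ideleGroup K)) [νA.IsMulLeftInvariant]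

/-- **Peeling off finitely many good places.** For every finite `F ⊆ Good`:
`∫_{B(Good ∖ F)} f dν = (∏_{v ∈ F} Σ_μ c_v(μ)) ∫_{B(Good)} f dν`. [folklore] -/
theorem setLIntegral_unitBox_diff_eq_prod_mul (Good : Set (HeightOneSpectrum (𝓞 K)))
    {ϖ : ∀ v : HeightOneSpectrum (𝓞 K), (v.adicCompletion K)ˣ}
    (hϖ : ∀ v ∈ Good, Valued.v ((ϖ v : v.adicCompletion K)) = WithZero.exp (-1 : ℤ))
    {f : (Fin n → ideleGroup K) → ℝ≥0∞} (hf : Measurable f)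
    (c : HeightOneSpectrum (𝓞 K) → (Fin n → ℕ) → ℝ≥0∞)
    (hscale : ∀ v ∈ Good, ∀ (mu : Fin n → ℕ) (a : Fin n → ideleGroup K),
      (∀ i, Valued.v (((a i : ideleGroup K) : AdeleRing (𝓞 K) K).2 v) = 1) →
      f (localTorusPow (ϖ v) mu * a) = c v mu * f a)
    (hsupp : ∀ v ∈ Good, ∀ a : Fin n → ideleGroup K,
      (∃ i, 1 < Valued.v (((a i : ideleGroup K) : AdeleRing (𝓞 K) K).2 v)) → f a = 0)
    (F : Finset (HeightOneSpectrum (𝓞 K))) (hF : (F : Set (HeightOneSpectrum (𝓞 K))) ⊆ Good) :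
    ∫⁻ a in unitBox (Good \ (F : Set (HeightOneSpectrum (𝓞 K)))), f a ∂νA =
      (∏ v ∈ F, ∑' mu : Fin n → ℕ, c v mu) * ∫⁻ a in unitBox Good, f a ∂νA := by
  classical
  induction F using Finset.induction_on with
  | empty => simp
  | insert v F hvF ih =>
    have hv : v ∈ Good := hF (Finset.mem_insert_self v F)
    have hF' : (F : Set (HeightOneSpectrum (𝓞 K))) ⊆ Good := fun w hw => hF (Finset.mem_insert_of_mem hw)
    set G : Set (HeightOneSpectrum (𝓞 K)) := Good \ ((insert v F : Finset _) : Set (HeightOneSpectrum (𝓞 K))) with hG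
    have hvG : v ∉ G := fun h => h.2 (Finset.mem_insert_self v F)
    have hGv : insert v G = Good \ (F : Set (HeightOneSpectrum (𝓞 K))) := by
      ext w
      simp only [hG, Set.mem_insert_iff, Set.mem_sdiff, Finset.coe_insert, Finset.mem_coe]
      constructor
      · rintro (rfl | ⟨hw, hw'⟩)
        · exact ⟨hv, fun h => hvF h⟩
        · exact ⟨hw, fun h => hw' (Or.inr h)⟩
      · rintro ⟨hw, hwF⟩
        by_cases hwv : w = v
        · exact Or.inl hwv
        · exact Or.inr ⟨hw, fun h => h.elim hwv hwF⟩
    have step := setLIntegral_unitBox_eq_tsum_mul νA (hϖ v hv) hvG hf (c v)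
      (fun mu a ha => hscale v hv mu a fun i => ha v (Set.mem_insert v G) i)
      (fun a _ ha => hsupp v hv a ha)
    rw [step, hGv, ih hF', Finset.prod_insert hvF, mul_assoc]

omit [MeasurableSpace (ideleGroup K)] [BorelSpace (ideleGroup K)] in
/-- **An idele is a unit at almost all places**, hence every point of the torus lies in `B(Good ∖ F)`
for some finite `F ⊆ Good`: `⋃_F B(Good ∖ F) = (𝔸_Kˣ)ⁿ`. [folklore] -/
theorem iUnion_unitBox_diff_eq_univ (Good : Set (HeightOneSpectrum (𝓞 K))) :
    ⋃ F : {F : Finset (HeightOneSpectrum (𝓞 K)) // (F : Set (HeightOneSpectrum (𝓞 K))) ⊆ Good},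
      unitBox (n := n) (K := K) (Good \ ((F : Finset (HeightOneSpectrum (𝓞 K))) : Set (HeightOneSpectrum (𝓞 K)))) =
      Set.univ := by
  classical
  refine Set.eq_univ_of_forall fun a => Set.mem_iUnion.2 ?_
  -- the bad places of `a` inside `Good`
  have hfin : ∀ i, {v : HeightOneSpectrum (𝓞 K) | Valued.v (((a i : ideleGroup K) : AdeleRing (𝓞 K) K).2 v) ≠ 1}.Finite := by
    intro i
    refine (hasFiniteMulSupport_norm_snd K (a i)).subset fun v hv => ?_
    rw [Function.mem_mulSupport]
    exact fun h1 => hv (norm_adicCompletion_eq_one_iff.1 h1)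
  set Bad : Set (HeightOneSpectrum (𝓞 K)) := ⋃ i, {v | Valued.v (((a i : ideleGroup K) : AdeleRing (𝓞 K) K).2 v) ≠ 1} with hBad
  have hBadfin : Bad.Finite := Set.finite_iUnion hfin
  set F : Finset (HeightOneSpectrum (𝓞 K)) := (hBadfin.inter_of_left Good).toFinset with hFdef
  have hFsub : (F : Set (HeightOneSpectrum (𝓞 K))) ⊆ Good := by
    intro w hw
    rw [hFdef, Set.Finite.coe_toFinset] at hw
    exact hw.2
  refine ⟨⟨F, hFsub⟩, fun w hw i => ?_⟩
  by_contra h1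
  have hwBad : w ∈ Bad := Set.mem_iUnion.2 ⟨i, h1⟩
  have hwF : w ∈ (F : Set (HeightOneSpectrum (𝓞 K))) := by
    rw [hFdef, Set.Finite.coe_toFinset]
    exact ⟨hwBad, hw.1⟩
  exact hw.2 hwF

omit [BorelSpace (ideleGroup K)] [νA.IsMulLeftInvariant] in
/-- **The torus integral as a supremum over the unit boxes `B(Good ∖ F)`** (monotone convergence along the
directed family of finite `F ⊆ Good`). [folklore] -/
theorem lintegral_eq_iSup_setLIntegral_unitBox_diff (Good : Set (HeightOneSpectrum (𝓞 K)))
    (f : (Fin n → ideleGroup K) → ℝ≥0∞) :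
    ∫⁻ a, f a ∂νA =
      ⨆ F : {F : Finset (HeightOneSpectrum (𝓞 K)) // (F : Set (HeightOneSpectrum (𝓞 K))) ⊆ Good},
        ∫⁻ a in unitBox (Good \ ((F : Finset (HeightOneSpectrum (𝓞 K))) : Set (HeightOneSpectrum (𝓞 K)))), f a ∂νA := by
  classical
  haveI : Countable (HeightOneSpectrum (𝓞 K)) := countable_heightOneSpectrum K
  have hdir : Directed (· ⊆ ·) fun F : {F : Finset (HeightOneSpectrum (𝓞 K)) // (F : Set (HeightOneSpectrum (𝓞 K))) ⊆ Good} =>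
      unitBox (n := n) (K := K) (Good \ ((F : Finset (HeightOneSpectrum (𝓞 K))) : Set (HeightOneSpectrum (𝓞 K)))) := by
    rintro ⟨F₁, h₁⟩ ⟨F₂, h₂⟩
    refine ⟨⟨F₁ ∪ F₂, fun w hw => ?_⟩, unitBox_mono (Set.sdiff_subset_sdiff_right (by simp)),
      unitBox_mono (Set.sdiff_subset_sdiff_right (by simp))⟩
    rw [Finset.coe_union] at hw
    exact hw.elim (fun h => h₁ h) (fun h => h₂ h)
  rw [← setLIntegral_iUnion_of_directed f hdir, iUnion_unitBox_diff_eq_univ Good, Measure.restrict_univ]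

/-- **The Euler bound for a torus integral.** Under the hypotheses of
`setLIntegral_unitBox_diff_eq_prod_mul`:
`∫ f dν ≤ (⨆_F ∏_{v ∈ F} Σ_μ c_v(μ)) · ∫_{B(Good)} f dν` (the supremum over the finite `F ⊆ Good`).
[folklore] -/
theorem lintegral_le_iSup_prod_mul_setLIntegral_unitBox (Good : Set (HeightOneSpectrum (𝓞 K)))
    {ϖ : ∀ v : HeightOneSpectrum (𝓞 K), (v.adicCompletion K)ˣ}
    (hϖ : ∀ v ∈ Good, Valued.v ((ϖ v : v.adicCompletion K)) = WithZero.exp (-1 : ℤ))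
    {f : (Fin n → ideleGroup K) → ℝ≥0∞} (hf : Measurable f)
    (c : HeightOneSpectrum (𝓞 K) → (Fin n → ℕ) → ℝ≥0∞)
    (hscale : ∀ v ∈ Good, ∀ (mu : Fin n → ℕ) (a : Fin n → ideleGroup K),
      (∀ i, Valued.v (((a i : ideleGroup K) : AdeleRing (𝓞 K) K).2 v) = 1) →
      f (localTorusPow (ϖ v) mu * a) = c v mu * f a)
    (hsupp : ∀ v ∈ Good, ∀ a : Fin n → ideleGroup K,
      (∃ i, 1 < Valued.v (((a i : ideleGroup K) : AdeleRing (𝓞 K) K).2 v)) → f a = 0) :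
    ∫⁻ a, f a ∂νA ≤
      (⨆ F : {F : Finset (HeightOneSpectrum (𝓞 K)) // (F : Set (HeightOneSpectrum (𝓞 K))) ⊆ Good},
          ∏ v ∈ (F : Finset (HeightOneSpectrum (𝓞 K))), ∑' mu : Fin n → ℕ, c v mu) *
        ∫⁻ a in unitBox Good, f a ∂νA := by
  rw [lintegral_eq_iSup_setLIntegral_unitBox_diff νA Good f, ENNReal.iSup_mul]
  refine iSup_mono fun F => ?_
  rw [setLIntegral_unitBox_diff_eq_prod_mul νA Good hϖ hf c hscale hsupp F.1 F.2]

end Euler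

end Literature.NumberTheory.Automorphic
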